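import Literature.Analysis.Distribution.NormalJetFieldCalculus
import Mathlib.Analysis.Calculus.FDeriv.Mul
import Mathlib.Analysis.Calculus.ContDiff.Operations
import Mathlib.RingTheory.Nilpotent.Basic
import HarnessLib

/-!
# Descent of the normal order along a first-order equation with nilpotent linearization

Topic `Analysis/Distribution`; namespace `Literature.Analysis.Distribution`. The inductive step of the
uniqueness argument for distributions carried by a linear subspace `{0} × Z ⊂ B × Z` and satisfying
first-order equations (Hörmander, Thm. 2.3.5 with §3.1: if `u = Σ_{|α| ≤ k} ∂^α δ ⊗ u_α` solves
`ᵗP u = 0` then the top coefficients solve the equation given by the principal part of `ᵗP` along the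
subspace):

Let `D` be additive and homogeneous on the test functions supported in `W` and satisfy
`D (V_i g) = μ_i D g` for smooth vector fields `V_i`. Suppose the combination `W = Σ c_i V_i` (real smooth
`c_i`) vanishes on the subspace near `x₀ = (0, z₀)`, that its normal linearization `L` at `x₀` is
nilpotent, and that `m(x₀) ≠ μ̄(x₀)` where `m = Σ V_i(c_i)` and `μ̄ = Σ c_i μ_i`. Then near `x₀` the
normal order of `D` drops by one: `NormalOrderBelow D V (j+1) → NormalOrderBelow D V' j`
(`NormalOrderBelow.descent_firstOrder`). The mechanism: on lifted jets `h = jetLift ε ν` the equations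
give `σ((Λ_L + m − μ̄) ν) = 0` for the top-jet functional `σ`, and `Λ_L + (m − μ̄)` (nilpotent plus a
non-zero scalar) is invertible with smooth inverse.

* §1 the operator `firstOrderSymbolOp L s = slotDerivCLM L + s • 1` on `NormalJetSpace B j`: nilpotency of
  `slotDerivCLM L` for nilpotent `L`, invertibility for `s ≠ 0`, commutation with `symmetrize`;
* §2 smooth dependence on parameters and smooth compactly supported inverses;
* §3 the identity `D (jetLift ε (M ν)) = 0`;
* §4 the descent theorem.

Everything is proved; no named fact is introduced.

## References

* L. Hörmander, *The Analysis of Linear Partial Differential Operators I* (1983), Thm. 2.3.5, §3.1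
  [HormanderALPDO1].
-/

noncomputable section

open Set Filter Topology Function Metric
open scoped ContDiff

namespace Literature.Analysis.Distribution

variable {B Z : Type*} [NormedAddCommGroup B] [NormedSpace ℝ B] [NormedAddCommGroup Z] [NormedSpace ℝ Z]

/-! ### 1. The first-order symbol operator on jets -/

section Op

/-- `slotDeriv L` as a continuous linear operator on `NormalJetSpace B j`. [folklore] -/
def slotDerivCLM {j : ℕ} (L : B →L[ℝ] B) : NormalJetSpace B j →L[ℝ] NormalJetSpace B j :=
  ∑ r : Fin j, ContinuousMultilinearMap.compContinuousLinearMapL (slotMap r L)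

/-- `slotDerivCLM L m = slotDeriv L m`. [folklore] -/
@[simp] theorem slotDerivCLM_apply {j : ℕ} (L : B →L[ℝ] B) (m : NormalJetSpace B j) : slotDerivCLM L m = slotDeriv L m := by
  simp [slotDerivCLM, slotDeriv]

/-- Composition of two reindexings of the arguments. [folklore] -/
theorem compContinuousLinearMap_compContinuousLinearMap {j : ℕ} (m : NormalJetSpace B j) (f g : Fin j → B →L[ℝ] B) :
    (m.compContinuousLinearMap f).compContinuousLinearMap g = m.compContinuousLinearMap fun i => (f i).comp (g i) := by
  ext v; simp [ContinuousMultilinearMap.compContinuousLinearMap_apply]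

/-- Powers of the one-slot operator: `(m ↦ m ∘_r L)^k = (m ↦ m ∘_r L^k)`. [folklore] -/
theorem compContinuousLinearMapL_slotMap_pow {j : ℕ} (r : Fin j) (L : B →L[ℝ] B) (k : ℕ) :
    ∀ m : NormalJetSpace B j,
      ((ContinuousMultilinearMap.compContinuousLinearMapL (slotMap r L) : NormalJetSpace B j →L[ℝ] NormalJetSpace B j) ^ k) m =
        m.compContinuousLinearMap (slotMap r (L ^ k)) := by
  induction k with
  | zero =>
    intro m
    rw [pow_zero, pow_zero]
    change m = _
    ext v
    simp only [ContinuousMultilinearMap.compContinuousLinearMap_apply]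
    congr 1; funext i; by_cases hir : i = r <;> simp [slotMap, hir]
  | succ k ih =>
    intro m
    rw [pow_succ']
    change ContinuousMultilinearMap.compContinuousLinearMapL (slotMap r L)
      ((((ContinuousMultilinearMap.compContinuousLinearMapL (slotMap r L) : NormalJetSpace B j →L[ℝ] NormalJetSpace B j) ^ k)) m) = _
    rw [ih, ContinuousMultilinearMap.compContinuousLinearMapL_apply, compContinuousLinearMap_compContinuousLinearMap]
    congr 1; funext i
    by_cases hir : i = r
    · subst hir; simp [slotMap, pow_succ, ContinuousLinearMap.mul_def]
    · simp [slotMap, hir]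

/-- The one-slot operators commute. [folklore] -/
theorem commute_compContinuousLinearMapL_slotMap {j : ℕ} (r r' : Fin j) (L : B →L[ℝ] B) :
    Commute (ContinuousMultilinearMap.compContinuousLinearMapL (slotMap r L) : NormalJetSpace B j →L[ℝ] NormalJetSpace B j)
      (ContinuousMultilinearMap.compContinuousLinearMapL (slotMap r' L)) := by
  refine ContinuousLinearMap.ext fun m => ?_
  change ((ContinuousMultilinearMap.compContinuousLinearMapL (slotMap r L)) ((ContinuousMultilinearMap.compContinuousLinearMapL (slotMap r' L)) m)) =
    ((ContinuousMultilinearMap.compContinuousLinearMapL (slotMap r' L)) ((ContinuousMultilinearMap.compContinuousLinearMapL (slotMap r L)) m))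
  simp only [ContinuousMultilinearMap.compContinuousLinearMapL_apply, compContinuousLinearMap_compContinuousLinearMap]
  congr 1; funext i
  by_cases hir : i = r
  · subst hir
    by_cases hir' : i = r'
    · subst hir'; rfl
    · simp [slotMap, hir']
  · by_cases hir' : i = r'
    · subst hir'; simp [slotMap, hir]
    · simp [slotMap, hir, hir']

/-- **`slotDerivCLM L` is nilpotent when `L` is.** [folklore] -/
theorem isNilpotent_slotDerivCLM {j : ℕ} {L : B →L[ℝ] B} (hL : IsNilpotent L) : IsNilpotent (slotDerivCLM (j := j) L) := by
  obtain ⟨N, hN⟩ := hL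
  have hT : ∀ r : Fin j,
      ((ContinuousMultilinearMap.compContinuousLinearMapL (slotMap r L) : NormalJetSpace B j →L[ℝ] NormalJetSpace B j) ^ N) = 0 := by
    intro r
    refine ContinuousLinearMap.ext fun m => ?_
    rw [compContinuousLinearMapL_slotMap_pow, hN]
    change _ = (0 : NormalJetSpace B j)
    ext v
    rw [ContinuousMultilinearMap.compContinuousLinearMap_apply, zero_apply]
    exact m.map_coord_zero r (by simp [slotMap])
  exact Commute.isNilpotent_sum (fun r _ => ⟨N, hT r⟩) fun r r' _ _ => commute_compContinuousLinearMapL_slotMap r r' L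

/-- **The first-order symbol operator** `M = Λ_L + s` on order-`j` jets. [cite: HormanderALPDO1, Thm. 2.3.5, §3.1] -/
def firstOrderSymbolOp {j : ℕ} (L : B →L[ℝ] B) (s : ℂ) : NormalJetSpace B j →L[ℝ] NormalJetSpace B j :=
  slotDerivCLM L + s • ContinuousLinearMap.id ℝ (NormalJetSpace B j)

/-- `firstOrderSymbolOp L s m = slotDeriv L m + s • m`. [folklore] -/
@[simp] theorem firstOrderSymbolOp_apply {j : ℕ} (L : B →L[ℝ] B) (s : ℂ) (m : NormalJetSpace B j) :
    firstOrderSymbolOp L s m = slotDeriv L m + s • m := by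
  simp [firstOrderSymbolOp]

/-- **Nilpotent plus non-zero scalar is invertible**: `firstOrderSymbolOp L s` is a unit for nilpotent `L`
and `s ≠ 0`. [folklore] -/
theorem isUnit_firstOrderSymbolOp {j : ℕ} {L : B →L[ℝ] B} (hL : IsNilpotent L) {s : ℂ} (hs : s ≠ 0) :
    IsUnit (firstOrderSymbolOp (j := j) L s) := by
  set S : NormalJetSpace B j →L[ℝ] NormalJetSpace B j := s • ContinuousLinearMap.id ℝ (NormalJetSpace B j)
  have hSunit : IsUnit S := by
    refine ⟨⟨S, s⁻¹ • ContinuousLinearMap.id ℝ (NormalJetSpace B j), ?_, ?_⟩, rfl⟩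
    · refine ContinuousLinearMap.ext fun m => ?_
      change S ((s⁻¹ • ContinuousLinearMap.id ℝ (NormalJetSpace B j)) m) = m
      simp [S, smul_smul, hs]
    · refine ContinuousLinearMap.ext fun m => ?_
      change (s⁻¹ • ContinuousLinearMap.id ℝ (NormalJetSpace B j)) (S m) = m
      simp [S, smul_smul, hs]
  have hcomm : Commute (slotDerivCLM (j := j) L) S := by
    refine ContinuousLinearMap.ext fun m => ?_
    change slotDerivCLM L (S m) = S (slotDerivCLM L m)
    simp [S, slotDeriv_smul]
  exact IsNilpotent.isUnit_add_right_of_commute (R := NormalJetSpace B j →L[ℝ] NormalJetSpace B j)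
    (isNilpotent_slotDerivCLM hL) hSunit hcomm

/-- A unit of the operator ring is an invertible continuous linear map. [folklore] -/
theorem isInvertible_of_isUnit {j : ℕ} {f : NormalJetSpace B j →L[ℝ] NormalJetSpace B j} (hf : IsUnit f) : f.IsInvertible := by
  obtain ⟨u, rfl⟩ := hf
  exact ⟨ContinuousLinearEquiv.unitsEquiv ℝ (NormalJetSpace B j) u, by ext m; rfl⟩

/-- **`slotDeriv` commutes with symmetrisation.** [folklore] -/
theorem symmetrize_slotDeriv {j : ℕ} (L : B →L[ℝ] B) (m : NormalJetSpace B j) :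
    symmetrize (slotDeriv L m) = slotDeriv L (symmetrize m) := by
  ext v
  rw [symmetrize_apply, slotDeriv_apply]
  have h1 : ∀ σ : Equiv.Perm (Fin j), slotDeriv L m (v ∘ σ) = ∑ r, m (update v r (L (v r)) ∘ σ) := fun σ => by
    rw [slotDeriv_apply]
    have h2 : ∀ r, m (update (v ∘ σ) r (L ((v ∘ σ) r))) = m (update v (σ r) (L (v (σ r))) ∘ σ) := fun r => by
      rw [update_comp_equiv]; simp
    simp_rw [h2]
    exact Equiv.sum_comp σ (fun r => m (update v r (L (v r)) ∘ σ))
  simp_rw [h1, symmetrize_apply]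
  rw [Finset.sum_comm, Finset.mul_sum]

/-- `firstOrderSymbolOp` commutes with symmetrisation. [folklore] -/
theorem symmetrize_firstOrderSymbolOp {j : ℕ} (L : B →L[ℝ] B) (s : ℂ) (m : NormalJetSpace B j) :
    symmetrize (firstOrderSymbolOp L s m) = firstOrderSymbolOp L s (symmetrize m) := by
  rw [firstOrderSymbolOp_apply, firstOrderSymbolOp_apply, symmetrize_add, symmetrize_smul, symmetrize_slotDeriv]

end Op

/-! ### 2. Smooth dependence and smooth inverses -/

section Smooth

/-- `z ↦ slotDerivCLM (L z)` is smooth for smooth `L`. [folklore] -/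
theorem contDiff_slotDerivCLM {j : ℕ} {L : Z → B →L[ℝ] B} (hL : ContDiff ℝ ∞ L) :
    ContDiff ℝ ∞ fun z => slotDerivCLM (j := j) (L z) := by
  unfold slotDerivCLM
  refine ContDiff.sum fun r _ => ?_
  have h1 : (fun z => (ContinuousMultilinearMap.compContinuousLinearMapL (slotMap r (L z)) :
      NormalJetSpace B j →L[ℝ] NormalJetSpace B j)) =
      (fun f => ContinuousMultilinearMap.compContinuousLinearMapContinuousMultilinear ℝ (fun _ : Fin j => B) (fun _ : Fin j => B) ℂ f) ∘
        fun z => slotMap r (L z) := by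
    funext z; rfl
  rw [h1]
  refine (ContinuousMultilinearMap.contDiff _).comp (contDiff_pi.2 fun i => ?_)
  by_cases hir : i = r
  · subst hir; simpa [slotMap] using hL
  · simpa [slotMap, hir] using contDiff_const

/-- `z ↦ firstOrderSymbolOp (L z) (s z)` is smooth. [folklore] -/
theorem contDiff_firstOrderSymbolOp {j : ℕ} {L : Z → B →L[ℝ] B} (hL : ContDiff ℝ ∞ L) {s : Z → ℂ} (hs : ContDiff ℝ ∞ s) :
    ContDiff ℝ ∞ fun z => firstOrderSymbolOp (j := j) (L z) (s z) := by
  letI : NormedSpace ℂ (NormalJetSpace B j →L[ℝ] NormalJetSpace B j) := ContinuousLinearMap.toNormedSpace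
  unfold firstOrderSymbolOp
  exact (contDiff_slotDerivCLM hL).add (hs.smul contDiff_const)

/-- **Smooth compactly supported right inverse**: if `M : Z → End(S)` is smooth and invertible on the support
of `ν₀`, then `ν₀ = M ν'` with `ν'` smooth, compactly supported inside `tsupport ν₀`. [folklore] -/
theorem exists_smooth_preimage {j : ℕ} {M : Z → NormalJetSpace B j →L[ℝ] NormalJetSpace B j} (hM : ContDiff ℝ ∞ M)
    {ν₀ : Z → NormalJetSpace B j} (hν₀ : ContDiff ℝ ∞ ν₀) (hν₀c : HasCompactSupport ν₀)
    (hinv : ∀ z ∈ tsupport ν₀, (M z).IsInvertible) :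
    ∃ ν' : Z → NormalJetSpace B j, ContDiff ℝ ∞ ν' ∧ HasCompactSupport ν' ∧ tsupport ν' ⊆ tsupport ν₀ ∧
      ∀ z, M z (ν' z) = ν₀ z := by
  set ν' : Z → NormalJetSpace B j := fun z => (M z).inverse (ν₀ z)
  have hsupp : Function.support ν' ⊆ Function.support ν₀ := by
    intro z hz
    rw [Function.mem_support] at hz ⊢
    intro h0
    exact hz (by simp [ν', h0])
  have htsupp : tsupport ν' ⊆ tsupport ν₀ := closure_mono hsupp
  refine ⟨ν', ?_, IsCompact.of_isClosed_subset hν₀c (isClosed_tsupport _) htsupp, htsupp, fun z => ?_⟩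
  · rw [contDiff_iff_contDiffAt]
    intro z
    by_cases hz : z ∈ tsupport ν₀
    · have h1 : ContDiffAt ℝ ∞ (fun z' => (M z').inverse) z :=
        ((hinv z hz).contDiffAt_map_inverse).comp z hM.contDiffAt
      exact h1.clm_apply hν₀.contDiffAt
    · have h0 : ν' =ᶠ[𝓝 z] fun _ => 0 := by
        have hν0 : ν₀ =ᶠ[𝓝 z] fun _ => 0 := notMem_tsupport_iff_eventuallyEq.1 hz
        filter_upwards [hν0] with z' hz'
        simp [ν', hz']
      exact (contDiffAt_const (c := (0 : NormalJetSpace B j))).congr_of_eventuallyEq h0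
  · by_cases hz : z ∈ tsupport ν₀
    · exact (((hinv z hz).inverse_apply_eq).1 rfl).symm
    · have h0 : ν₀ z = 0 := image_eq_zero_of_notMem_tsupport hz
      simp [ν', h0]

end Smooth

/-! ### 3. The data of the descent and the key identity -/

section Data

variable [FiniteDimensional ℝ B] [FiniteDimensional ℝ Z]
variable {ι : Type*} [Fintype ι]

/-- The combination `W = Σ_i c_i V_i` of the vector fields. [folklore] -/
def totField (c : ι → B × Z → ℝ) (Vf : ι → B × Z → B × Z) (x : B × Z) : B × Z := ∑ i, c i x • Vf i x

/-- The multiplier `m = Σ_i V_i(c_i)`. [folklore] -/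
def multFn (c : ι → B × Z → ℝ) (Vf : ι → B × Z → B × Z) (x : B × Z) : ℝ := ∑ i, fderiv ℝ (c i) x (Vf i x)

/-- The combined eigenvalue `μ̄ = Σ_i c_i μ_i`. [folklore] -/
def eigFn (c : ι → B × Z → ℝ) (μ : ι → ℂ) (x : B × Z) : ℂ := ∑ i, (c i x : ℂ) * μ i

/-- The scalar part `m(0,z) - μ̄(0,z)` of the symbol. [folklore] -/
def symbolScalar (c : ι → B × Z → ℝ) (Vf : ι → B × Z → B × Z) (μ : ι → ℂ) (z : Z) : ℂ :=
  (multFn c Vf ((0 : B), z) : ℂ) - eigFn c μ ((0 : B), z)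

/-- **The first-order symbol operator of the data at `z`**: `Λ_{L_z} + (m - μ̄)(0,z)` on order-`j` jets,
`L_z` the normal linearization of `W`. [cite: HormanderALPDO1, Thm. 2.3.5, §3.1] -/
def symbolOpAt (c : ι → B × Z → ℝ) (Vf : ι → B × Z → B × Z) (μ : ι → ℂ) (j : ℕ) (z : Z) :
    NormalJetSpace B j →L[ℝ] NormalJetSpace B j :=
  firstOrderSymbolOp (normalLinearization (totField c Vf) z) (symbolScalar c Vf μ z)

omit [FiniteDimensional ℝ B] [FiniteDimensional ℝ Z] in
/-- `totField` is smooth. [folklore] -/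
theorem contDiff_totField {c : ι → B × Z → ℝ} {Vf : ι → B × Z → B × Z} (hc : ∀ i, ContDiff ℝ ∞ (c i))
    (hVf : ∀ i, ContDiff ℝ ∞ (Vf i)) : ContDiff ℝ ∞ (totField c Vf) :=
  ContDiff.sum fun i _ => (hc i).smul (hVf i)

omit [FiniteDimensional ℝ B] [FiniteDimensional ℝ Z] in
/-- `multFn` is smooth. [folklore] -/
theorem contDiff_multFn {c : ι → B × Z → ℝ} {Vf : ι → B × Z → B × Z} (hc : ∀ i, ContDiff ℝ ∞ (c i))
    (hVf : ∀ i, ContDiff ℝ ∞ (Vf i)) : ContDiff ℝ ∞ (multFn c Vf) :=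
  ContDiff.sum fun i _ => ((hc i).fderiv_right (m := ∞) (by norm_cast)).clm_apply (hVf i)

omit [FiniteDimensional ℝ B] [FiniteDimensional ℝ Z] in
/-- `eigFn` is smooth. [folklore] -/
theorem contDiff_eigFn {c : ι → B × Z → ℝ} (hc : ∀ i, ContDiff ℝ ∞ (c i)) (μ : ι → ℂ) : ContDiff ℝ ∞ (eigFn c μ) :=
  ContDiff.sum fun i _ => (Complex.ofRealCLM.contDiff.comp (hc i)).mul contDiff_const

omit [FiniteDimensional ℝ B] [FiniteDimensional ℝ Z] in
/-- The normal linearization of a smooth field depends smoothly on `z`. [folklore] -/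
theorem contDiff_normalLinearization {W : B × Z → B × Z} (hW : ContDiff ℝ ∞ W) : ContDiff ℝ ∞ (normalLinearization W) := by
  have h1 : ContDiff ℝ ∞ fun z : Z => fderiv ℝ W ((0 : B), z) :=
    (hW.fderiv_right (m := ∞) (by norm_cast)).comp ((contDiff_const (c := (0 : B))).prodMk contDiff_id)
  exact (contDiff_const (c := ContinuousLinearMap.fst ℝ B Z)).clm_comp (h1.clm_comp contDiff_const)

omit [FiniteDimensional ℝ B] [FiniteDimensional ℝ Z] in
/-- `z ↦ symbolOpAt … z` is smooth. [folklore] -/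
theorem contDiff_symbolOpAt {c : ι → B × Z → ℝ} {Vf : ι → B × Z → B × Z} (hc : ∀ i, ContDiff ℝ ∞ (c i))
    (hVf : ∀ i, ContDiff ℝ ∞ (Vf i)) (μ : ι → ℂ) (j : ℕ) : ContDiff ℝ ∞ (symbolOpAt c Vf μ j) := by
  unfold symbolOpAt symbolScalar
  refine contDiff_firstOrderSymbolOp (contDiff_normalLinearization (contDiff_totField hc hVf)) ?_
  have h0 : ContDiff ℝ ∞ fun z : Z => (((0 : B), z) : B × Z) := (contDiff_const (c := (0 : B))).prodMk contDiff_id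
  exact ((Complex.ofRealCLM.contDiff.comp (contDiff_multFn hc hVf)).comp h0).sub ((contDiff_eigFn hc μ).comp h0)

omit [FiniteDimensional ℝ B] [FiniteDimensional ℝ Z] in
/-- **The transposed equation on lifts**: `Σ_i V_i (c_i g) = W g + m g`. [folklore] -/
theorem sum_fieldDerivC_mul_eq {c : ι → B × Z → ℝ} {Vf : ι → B × Z → B × Z} (hc : ∀ i, ContDiff ℝ ∞ (c i))
    {g : B × Z → ℂ} (hg : Differentiable ℝ g) :
    ∑ i, fieldDerivC (Vf i) ((fun x => (c i x : ℂ)) * g) =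
      fieldDerivC (totField c Vf) g + (fun x => (multFn c Vf x : ℂ)) * g := by
  funext x
  have hW : totField c Vf = fun y => ∑ i ∈ Finset.univ, (fun i y => c i y • Vf i y) i y := rfl
  rw [Finset.sum_apply, Pi.add_apply, Pi.mul_apply, hW, fieldDerivC_finset_sum_field]
  simp only [fieldDerivC_smul_field, multFn]
  have h1 : ∀ i, fieldDerivC (Vf i) ((fun x => (c i x : ℂ)) * g) x =
      (c i x : ℂ) * fieldDerivC (Vf i) g x + ((fderiv ℝ (c i) x (Vf i x) : ℝ) : ℂ) * g x := by
    intro i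
    have hci : Differentiable ℝ fun x => (c i x : ℂ) := (Complex.ofRealCLM.differentiable.comp ((hc i).differentiable (by simp)))
    rw [fieldDerivC_mul hci hg, Pi.add_apply, Pi.mul_apply, Pi.mul_apply, fieldDerivC_apply (Vf i) (fun x => (c i x : ℂ)),
      vecDeriv_ofReal_comp ((hc i).differentiable (by simp))]
  simp_rw [h1]
  push_cast
  rw [Finset.sum_add_distrib, Finset.sum_mul]

variable {D : (B × Z → ℂ) → ℂ} {Wdom : Set (B × Z)} {c : ι → B × Z → ℝ} {Vf : ι → B × Z → B × Z} {μ : ι → ℂ}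

omit [NormedSpace ℝ B] [NormedSpace ℝ Z] [FiniteDimensional ℝ B] [FiniteDimensional ℝ Z] [Fintype ι] in
/-- `tsupport (m * g) ⊆ tsupport g`. [folklore] -/
theorem tsupport_mul_subset_right' (m g : B × Z → ℂ) : tsupport (m * g) ⊆ tsupport g :=
  closure_mono (Function.support_mul_subset_right m g)

omit [NormedAddCommGroup Z] [NormedSpace ℝ Z] [FiniteDimensional ℝ Z] [Fintype ι] in
/-- `jetLift` of a difference. [folklore] -/
theorem jetLift_sub {j : ℕ} (ε : ℝ) (ν ν' : Z → NormalJetSpace B j) : jetLift ε (ν - ν') = jetLift ε ν - jetLift ε ν' := by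
  funext x; simp [jetLift, diagFn]; ring

/-- **The key identity**: under the equations `D (V_i g) = μ_i D g`, the vanishing of `W` on the subspace
inside `V`, and `NormalOrderBelow D V (j+1)`, the top-jet functional kills the image of the symbol operator:
`D (jetLift ε (M ν)) = 0` for every smooth `ν` supported in `K` with `{‖b‖ ≤ 2ε} × K ⊆ V`.
[cite: HormanderALPDO1, Thm. 2.3.5, §3.1] -/
theorem apply_jetLift_symbolOpAt_eq_zero (hlin : IsLocallyLinearOn Wdom D) (hVf : ∀ i, ContDiff ℝ ∞ (Vf i))
    (hc : ∀ i, ContDiff ℝ ∞ (c i))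
    (heq : ∀ (i : ι) (g : B × Z → ℂ), IsTestFn g → tsupport g ⊆ Wdom → D (fieldDerivC (Vf i) g) = μ i * D g)
    {V : Set (B × Z)} (hVW : V ⊆ Wdom) (hvan : ∀ x ∈ V, x.1 = 0 → totField c Vf x = 0)
    {j : ℕ} (hD : NormalOrderBelow D V (j + 1)) {ε : ℝ} (hε : 0 < ε) {K : Set Z}
    (hKV : {x : B × Z | ‖x.1‖ ≤ 2 * ε} ∩ Prod.snd ⁻¹' K ⊆ V)
    {ν : Z → NormalJetSpace B j} (hν : ContDiff ℝ ∞ ν) (hνc : HasCompactSupport ν) (hνK : tsupport ν ⊆ K) :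
    D (jetLift ε (fun z => symbolOpAt c Vf μ j z (ν z))) = 0 := by
  -- the lift and its properties
  set hL := jetLift ε ν with hLdef
  have hLt : IsTestFn hL := isTestFn_jetLift hε hν hνc
  have hLsupp : tsupport hL ⊆ {x : B × Z | ‖x.1‖ ≤ 2 * ε} ∩ Prod.snd ⁻¹' K :=
    (tsupport_jetLift_subset hε ν).trans (inter_subset_inter_right _ (preimage_mono hνK))
  have hLV : tsupport hL ⊆ V := hLsupp.trans hKV
  have hLflat : NormalJetsVanishBelow j hL := normalJetsVanishBelow_jetLift hε hν
  have hW : ContDiff ℝ ∞ (totField c Vf) := contDiff_totField hc hVf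
  have hmC : ContDiff ℝ ∞ fun x => (multFn c Vf x : ℂ) := Complex.ofRealCLM.contDiff.comp (contDiff_multFn hc hVf)
  have heC : ContDiff ℝ ∞ (eigFn c μ) := contDiff_eigFn hc μ
  have hcC : ∀ i, ContDiff ℝ ∞ fun x => (c i x : ℂ) := fun i => Complex.ofRealCLM.contDiff.comp (hc i)
  -- W vanishes on the subspace inside the support of the lift
  have hW0 : ∀ z : Z, ((0 : B), z) ∈ tsupport hL → totField c Vf ((0 : B), z) = 0 :=
    fun z hz => hvan _ (hLV hz) rfl
  -- the two sides F = W hL + m hL and G = μ̄ hL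
  set F : B × Z → ℂ := fieldDerivC (totField c Vf) hL + (fun x => (multFn c Vf x : ℂ)) * hL with hFdef
  set G : B × Z → ℂ := eigFn c μ * hL with hGdef
  have hF1 : IsTestFn (fieldDerivC (totField c Vf) hL) := hLt.fieldDerivC hW
  have hF2 : IsTestFn ((fun x => (multFn c Vf x : ℂ)) * hL) := hLt.mul_left hmC
  have hFt : IsTestFn F := hF1.add hF2
  have hGt : IsTestFn G := hLt.mul_left heC
  have hFsupp : tsupport F ⊆ tsupport hL :=
    (tsupport_add _ _).trans (union_subset (tsupport_fieldDerivC_subset _ _) (tsupport_mul_subset_right' _ _))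
  have hGsupp : tsupport G ⊆ tsupport hL := tsupport_mul_subset_right' _ _
  -- (1) D F = D G from the equations
  have hDFG : D F = D G := by
    have hsum := sum_fieldDerivC_mul_eq (Vf := Vf) hc (hLt.contDiff.differentiable (by simp))
    have hterm : ∀ i, IsTestFn ((fun x => (c i x : ℂ)) * hL) ∧ tsupport ((fun x => (c i x : ℂ)) * hL) ⊆ Wdom :=
      fun i => ⟨hLt.mul_left (hcC i), (tsupport_mul_subset_right' _ _).trans (hLV.trans hVW)⟩
    have hA := apply_finset_sum_of_additive hlin.add (fun i => fieldDerivC (Vf i) ((fun x => (c i x : ℂ)) * hL)) Finset.univ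
      fun i _ => ⟨(hterm i).1.fieldDerivC (hVf i), (tsupport_fieldDerivC_subset _ _).trans (hterm i).2⟩
    have hB := apply_finset_sum_of_additive hlin.add (fun i => μ i • ((fun x => (c i x : ℂ)) * hL)) Finset.univ
      fun i _ => ⟨(hterm i).1.smul (μ i), by
        refine (closure_mono fun x hx => ?_).trans (hterm i).2
        rw [Function.mem_support] at hx ⊢
        intro h0; exact hx (by simp [h0])⟩
    have hGsum : G = ∑ i, μ i • ((fun x => (c i x : ℂ)) * hL) := by
      funext x
      simp only [hGdef, Pi.mul_apply, eigFn, Finset.sum_apply, Pi.smul_apply, smul_eq_mul, Finset.sum_mul]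
      refine Finset.sum_congr rfl fun i _ => ?_
      ring
    rw [show F = ∑ i, fieldDerivC (Vf i) ((fun x => (c i x : ℂ)) * hL) from hsum.symm, hA.2.2, hGsum, hB.2.2]
    refine Finset.sum_congr rfl fun i _ => ?_
    rw [heq i _ (hterm i).1 (hterm i).2, hlin.smul (μ i) _ (hterm i).1 (hterm i).2]
  -- (2) flatness below `j`
  have hFflat : NormalJetsVanishBelow j F :=
    (hLflat.fieldDerivC hW hLt.contDiff hW0).add (contDiff_fieldDerivC hW hLt.contDiff) (hmC.mul hLt.contDiff)
      (hLflat.mul_left hmC hLt.contDiff)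
  have hGflat : NormalJetsVanishBelow j G := hLflat.mul_left heC hLt.contDiff
  -- (3) the top jets
  have hjet : ∀ z, normalJet j F z - normalJet j G z = symmetrize (symbolOpAt c Vf μ j z (ν z)) := by
    intro z
    by_cases hz : ((0 : B), z) ∈ tsupport hL
    · have hpt : PtFlat j hL z := (normalJetsVanishBelow_iff_ptFlat j hL).1 hLflat z
      have hmCL : ContDiff ℝ ∞ ((fun x => (multFn c Vf x : ℂ)) * hL) := hmC.mul hLt.contDiff
      rw [hFdef, normalJet_add (contDiff_fieldDerivC hW hLt.contDiff) hmCL, normalJet_fieldDerivC hW hLt.contDiff hLflat (hW0 z hz),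
        normalJet_mul_of_ptFlat hmC hLt.contDiff hpt, hGdef, normalJet_mul_of_ptFlat heC hLt.contDiff hpt, hLdef,
        normalJet_jetLift_self hε hν, symbolOpAt, symmetrize_firstOrderSymbolOp, firstOrderSymbolOp_apply, symbolScalar,
        sub_smul (multFn c Vf ((0 : B), z) : ℂ) (eigFn c μ ((0 : B), z)) (symmetrize (ν z))]
      abel
    · have hF0 : normalJet j F z = 0 := normalJet_eq_zero_of_notMem_tsupport (fun hm => hz (hFsupp hm)) j
      have hG0 : normalJet j G z = 0 := normalJet_eq_zero_of_notMem_tsupport (fun hm => hz (hGsupp hm)) j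
      have hν0 : symmetrize (ν z) = 0 := by
        rw [← normalJet_jetLift_self hε hν z]
        exact normalJet_eq_zero_of_notMem_tsupport hz j
      rw [hF0, hG0, sub_zero, symbolOpAt, symmetrize_firstOrderSymbolOp, hν0, map_zero]
  -- (4) both sides factor through the top jet
  have hJsupp : ∀ {Φ : B × Z → ℂ}, tsupport Φ ⊆ tsupport hL → tsupport (jetLift ε (normalJet j Φ)) ⊆ V := by
    intro Φ hΦ
    refine (tsupport_jetLift_subset hε _).trans ((inter_subset_inter_right _ (preimage_mono fun z hz => ?_)).trans hKV)
    exact (hLsupp (hΦ (tsupport_normalJet_subset Φ j hz))).2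
  have hDF := NormalOrderBelow.apply_eq_apply_jetLift hlin hVW hD hε hFt (hFsupp.trans hLV) hFflat (hJsupp hFsupp)
  have hDG := NormalOrderBelow.apply_eq_apply_jetLift hlin hVW hD hε hGt (hGsupp.trans hLV) hGflat (hJsupp hGsupp)
  have htF : IsTestFn (jetLift ε (normalJet j F)) :=
    isTestFn_jetLift hε (contDiff_normalJet hFt.contDiff j) (hasCompactSupport_normalJet hFt.hasCompactSupport j)
  have htG : IsTestFn (jetLift ε (normalJet j G)) :=
    isTestFn_jetLift hε (contDiff_normalJet hGt.contDiff j) (hasCompactSupport_normalJet hGt.hasCompactSupport j)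
  have hsub := hlin.sub htF htG ((hJsupp hFsupp).trans hVW) ((hJsupp hGsupp).trans hVW)
  have hfun : normalJet j F - normalJet j G = fun z => symmetrize (symbolOpAt c Vf μ j z (ν z)) :=
    funext fun z => by rw [Pi.sub_apply, hjet z]
  rw [← jetLift_sub, hfun, jetLift_symmetrize] at hsub
  rw [hsub, ← hDF, ← hDG, hDFG, sub_self]

end Data


/-! ### 4. The descent theorem -/

section Descent

variable [FiniteDimensional ℝ B] [FiniteDimensional ℝ Z]
variable {ι : Type*} [Fintype ι]
variable {D : (B × Z → ℂ) → ℂ} {Wdom : Set (B × Z)} {c : ι → B × Z → ℝ} {Vf : ι → B × Z → B × Z} {μ : ι → ℂ}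

omit [FiniteDimensional ℝ B] [FiniteDimensional ℝ Z] in
/-- The set where the symbol operator is invertible is open. [folklore] -/
theorem isOpen_setOf_isInvertible_symbolOpAt (hc : ∀ i, ContDiff ℝ ∞ (c i)) (hVf : ∀ i, ContDiff ℝ ∞ (Vf i)) (μ : ι → ℂ)
    (j : ℕ) : IsOpen {z : Z | (symbolOpAt c Vf μ j z).IsInvertible} := by
  have h1 : {z : Z | (symbolOpAt c Vf μ j z).IsInvertible} =
      symbolOpAt c Vf μ j ⁻¹' range ((↑) : (NormalJetSpace B j ≃L[ℝ] NormalJetSpace B j) → NormalJetSpace B j →L[ℝ] NormalJetSpace B j) := by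
    ext z
    simp only [mem_setOf_eq, mem_preimage, mem_range, ContinuousLinearMap.IsInvertible]
  rw [h1]
  exact ContinuousLinearEquiv.isOpen.preimage (contDiff_symbolOpAt hc hVf μ j).continuous

omit [NormedSpace ℝ B] [NormedSpace ℝ Z] [FiniteDimensional ℝ B] [FiniteDimensional ℝ Z] [Fintype ι] in
/-- A cylinder `{‖b‖ ≤ 2ε} × closedBall z₀ ρ` inside a ball. [folklore] -/
theorem cylinder_subset_ball {z₀ : Z} {r ε ρ : ℝ} (hε : 2 * ε < r) (hρ : ρ < r) :
    {x : B × Z | ‖x.1‖ ≤ 2 * ε} ∩ Prod.snd ⁻¹' closedBall z₀ ρ ⊆ ball (((0 : B), z₀) : B × Z) r := by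
  rintro x ⟨hx1, hx2⟩
  rw [mem_setOf_eq] at hx1
  rw [mem_preimage, mem_closedBall] at hx2
  rw [mem_ball, Prod.dist_eq, max_lt_iff]
  exact ⟨by rw [dist_zero_right]; linarith, by linarith⟩

/-- **Descent of the normal order along a first-order equation with nilpotent normal linearization**
(the inductive step of Hörmander's uniqueness argument for `Σ ∂^α δ ⊗ u_α`): if `D` is locally linear on
`W ⊇ U`, satisfies `D (V_i g) = μ_i D g`, the combination `Σ c_i V_i` vanishes on `U ∩ ({0} × Z)`, its normal
linearization at `(0, z₀)` is nilpotent and `m(0,z₀) ≠ μ̄(0,z₀)`, then for every `j` and every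
neighbourhood `V ⊆ U` of `(0, z₀)` with `NormalOrderBelow D V (j+1)` there is a neighbourhood `V' ⊆ V`
with `NormalOrderBelow D V' j`. [cite: HormanderALPDO1, Thm. 2.3.5, §3.1] -/
theorem NormalOrderBelow.descent_firstOrder (hlin : IsLocallyLinearOn Wdom D) (hVf : ∀ i, ContDiff ℝ ∞ (Vf i))
    (hc : ∀ i, ContDiff ℝ ∞ (c i))
    (heq : ∀ (i : ι) (g : B × Z → ℂ), IsTestFn g → tsupport g ⊆ Wdom → D (fieldDerivC (Vf i) g) = μ i * D g)
    {U : Set (B × Z)} (hUW : U ⊆ Wdom) (hvan : ∀ x ∈ U, x.1 = 0 → totField c Vf x = 0) {z₀ : Z}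
    (hnil : IsNilpotent (normalLinearization (totField c Vf) z₀))
    (hne : ((multFn c Vf ((0 : B), z₀) : ℝ) : ℂ) ≠ eigFn c μ ((0 : B), z₀))
    (j : ℕ) {V : Set (B × Z)} (hV : V ∈ 𝓝 (((0 : B), z₀) : B × Z)) (hVU : V ⊆ U) (hD : NormalOrderBelow D V (j + 1)) :
    ∃ V' ∈ 𝓝 (((0 : B), z₀) : B × Z), V' ⊆ V ∧ NormalOrderBelow D V' j := by
  set M := symbolOpAt c Vf μ j with hMdef
  have hM : ContDiff ℝ ∞ M := contDiff_symbolOpAt hc hVf μ j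
  -- invertibility at `z₀` and nearby
  have hinv0 : (M z₀).IsInvertible :=
    isInvertible_of_isUnit (isUnit_firstOrderSymbolOp hnil (sub_ne_zero.2 hne))
  have hO : IsOpen {z : Z | (M z).IsInvertible} := isOpen_setOf_isInvertible_symbolOpAt hc hVf μ j
  obtain ⟨ρ₀, hρ₀, hρ₀O⟩ := Metric.mem_nhds_iff.1 (hO.mem_nhds hinv0)
  -- the sizes
  obtain ⟨r, hr, hrV⟩ := Metric.mem_nhds_iff.1 hV
  set ε : ℝ := r / 4 with hεdef
  have hε : 0 < ε := by positivity
  set ρ : ℝ := min (r / 2) (ρ₀ / 2) with hρdef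
  have hρ : 0 < ρ := lt_min (by positivity) (by positivity)
  have hρr : ρ < r := (min_le_left _ _).trans_lt (by linarith)
  have hρO : closedBall z₀ ρ ⊆ {z : Z | (M z).IsInvertible} :=
    (closedBall_subset_ball ((min_le_right _ _).trans_lt (by linarith))).trans hρ₀O
  have hKV : {x : B × Z | ‖x.1‖ ≤ 2 * ε} ∩ Prod.snd ⁻¹' closedBall z₀ ρ ⊆ V :=
    (cylinder_subset_ball (by rw [hεdef]; linarith) hρr).trans hrV
  -- the new neighbourhood
  refine ⟨ball (0 : B) ε ×ˢ ball z₀ ρ, prod_mem_nhds (ball_mem_nhds _ hε) (ball_mem_nhds _ hρ), ?_, ?_⟩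
  · rintro x ⟨hx1, hx2⟩
    refine hKV ⟨?_, ?_⟩
    · rw [mem_setOf_eq]
      rw [mem_ball, dist_zero_right] at hx1
      linarith
    · exact mem_preimage.2 (ball_subset_closedBall hx2)
  · intro h hh hhV' hflat
    -- the top jet of `h`, supported inside `closedBall z₀ ρ`
    set ν₀ := normalJet j h
    have hν₀ : ContDiff ℝ ∞ ν₀ := contDiff_normalJet hh.contDiff j
    have hν₀c : HasCompactSupport ν₀ := hasCompactSupport_normalJet hh.hasCompactSupport j
    have hν₀K : tsupport ν₀ ⊆ closedBall z₀ ρ := fun z hz =>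
      ball_subset_closedBall (hhV' (tsupport_normalJet_subset h j hz)).2
    have hhV : tsupport h ⊆ V := hhV'.trans fun x hx => hKV ⟨by
      rw [mem_setOf_eq]; have := hx.1; rw [mem_ball, dist_zero_right] at this; linarith,
      mem_preimage.2 (ball_subset_closedBall hx.2)⟩
    -- solve `M ν' = ν₀`
    obtain ⟨ν', hν', hν'c, hν'supp, hν'eq⟩ :=
      exists_smooth_preimage hM hν₀ hν₀c fun z hz => hρO (hν₀K hz)
    -- `D h = D (jetLift ε ν₀) = D (jetLift ε (M ν')) = 0`
    have hliftV : tsupport (jetLift ε ν₀) ⊆ V :=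
      (tsupport_jetLift_subset hε ν₀).trans ((inter_subset_inter_right _ (preimage_mono hν₀K)).trans hKV)
    rw [NormalOrderBelow.apply_eq_apply_jetLift hlin (hVU.trans hUW) hD hε hh hhV hflat hliftV,
      show normalJet j h = fun z => M z (ν' z) from funext fun z => (hν'eq z).symm]
    exact apply_jetLift_symbolOpAt_eq_zero hlin hVf hc heq (hVU.trans hUW) (fun x hx hx0 => hvan x (hVU hx) hx0) hD hε hKV
      hν' hν'c (hν'supp.trans hν₀K)

/-- **Iterated descent**: under the same hypotheses, `NormalOrderBelow D V (k+1)` near `(0,z₀)` forces `D` to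
vanish on all test functions supported in some neighbourhood of `(0, z₀)`. [cite: HormanderALPDO1, Thm. 2.3.5] -/
theorem NormalOrderBelow.vanish_of_firstOrder (hlin : IsLocallyLinearOn Wdom D) (hVf : ∀ i, ContDiff ℝ ∞ (Vf i))
    (hc : ∀ i, ContDiff ℝ ∞ (c i))
    (heq : ∀ (i : ι) (g : B × Z → ℂ), IsTestFn g → tsupport g ⊆ Wdom → D (fieldDerivC (Vf i) g) = μ i * D g)
    {U : Set (B × Z)} (hUW : U ⊆ Wdom) (hvan : ∀ x ∈ U, x.1 = 0 → totField c Vf x = 0) {z₀ : Z}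
    (hnil : IsNilpotent (normalLinearization (totField c Vf) z₀))
    (hne : ((multFn c Vf ((0 : B), z₀) : ℝ) : ℂ) ≠ eigFn c μ ((0 : B), z₀)) :
    ∀ (k : ℕ) {V : Set (B × Z)}, V ∈ 𝓝 (((0 : B), z₀) : B × Z) → V ⊆ U → NormalOrderBelow D V k →
      ∃ V' ∈ 𝓝 (((0 : B), z₀) : B × Z), ∀ g : B × Z → ℂ, IsTestFn g → tsupport g ⊆ V' → D g = 0
  | 0, V, hV, _, hD => ⟨V, hV, fun g hg hgV => hD.apply_eq_zero hg hgV⟩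
  | k + 1, V, hV, hVU, hD => by
    obtain ⟨V', hV', hV'V, hD'⟩ := NormalOrderBelow.descent_firstOrder hlin hVf hc heq hUW hvan hnil hne k hV hVU hD
    exact NormalOrderBelow.vanish_of_firstOrder hlin hVf hc heq hUW hvan hnil hne k hV' (hV'V.trans hVU) hD'

end Descent


end Literature.Analysis.Distribution
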